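import Literature.NumberTheory.DiophantineGeometry.TateAlgorithmProofs
import HarnessLib

/-!
# Tate's algorithm, steps 3–10: discharge of `WeierstrassCurve.isAdditive_kodairaSymbolAt_iff`

Trunk: `DiophValNum` (companion proof file of
`Literature.NumberTheory.DiophantineGeometry.TateAlgorithm`, sibling of
`Literature.NumberTheory.DiophantineGeometry.TateAlgorithmProofs`, whose Parts 1–2 it uses).

`WeierstrassCurve.isAdditive_kodairaSymbolAt_iff_holds` discharges the named fact
`WeierstrassCurve.isAdditive_kodairaSymbolAt_iff` of `TateAlgorithm`: for an elliptic curve `W / K`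
and a finite place `v` whose completed residue field is perfect, the Kodaira symbol at `v` is of
additive type (`II, III, IV, Iₙ*, IV*, III*, II*`, i.e. neither `I₀` nor `Iₙ`, `n ≥ 1`) iff `W` has
additive reduction at `v` (Silverman, ATAEC IV.9.4: Step 1, p. 344, "if `π ∤ Δ` then Type `I₀`";
Step 2, p. 344, "if `π ∤ b₂` then Type `Iₙ`"; Steps 3–10, pp. 344–346, return
`II, III, IV, I₀*, Iₙ*, IV*, III*, II*`; Step 11, p. 346, "the original equation was not minimal";
and AEC VII.5.1(c): additive reduction iff `v (Δ) > 0` and `v (c₄) > 0` for a minimal equation).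

* `Literature.NumberTheory.DiophantineGeometry.TateAlgorithm.isAdditive_kodairaSymbolOfMinimal_iff` (DVR form): for `W` over a DVR `R`
  with perfect residue field, `Δ ≠ 0`, `W ⁄ K` minimal, `kodairaSymbolOfMinimal W` is additive iff
  `Δ ∈ 𝔪 ∧ c₄ ∈ 𝔪`. It combines `WeierstrassCurve.kodairaSymbolOfMinimal_eq_I_iff` (Part 1 of
  `TateAlgorithmProofs`: `Iₙ`, `n ≥ 1`, iff `π ∣ Δ` and `π ∤ c₄`), Step 1 (`I₀` if `π ∤ Δ`) and
  `Literature.NumberTheory.DiophantineGeometry.TateAlgorithm.kodairaSymbolOfMinimal_ne_I_zero` (Part 2: no `I₀` once `π ∣ Δ`, because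
  Step 11 is unreachable for a minimal equation over a DVR with perfect residue field).
* The bridge from Mathlib's `HasAdditiveReduction` (valuations on `K_v`) to `Δ ∈ 𝔪 ∧ c₄ ∈ 𝔪`
  for the integral local minimal model is inlined (it is also available as
  `WeierstrassCurve.hasAdditiveReductionAt_iff_mem` in the sibling file
  `TateAlgorithmOrdDiscriminant`, which this file does not import to keep its imports light).

## References

* J. H. Silverman, *Advanced Topics in the Arithmetic of Elliptic Curves*, GTM 151, 1994, §IV.9,
  Tate's algorithm 9.4, steps 1–11 (pp. 344–346), proof of step 2 (p. 347), proof of Cor. 9.1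
  (p. 356).
* J. H. Silverman, *The Arithmetic of Elliptic Curves*, GTM 106, 2nd ed. 2009, VII.5.1(c).
-/

open IsDedekindDomain

namespace Literature.NumberTheory.DiophantineGeometry

namespace TateAlgorithm

section DVR

variable {R : Type*} [CommRing R] [IsDomain R] [IsDiscreteValuationRing R]

/-- **Tate's algorithm detects additive reduction** (DVR form). For `W` over a DVR `R` with
perfect residue field, `Δ ≠ 0` and `W ⁄ K` minimal, the output of
`WeierstrassCurve.kodairaSymbolOfMinimal` is of additive type (neither `I₀` nor `Iₙ`, `n ≥ 1`) iff
`π ∣ Δ` and `π ∣ c₄`. Direction `→`: `π ∤ Δ` is Step 1 (`I₀`), and `π ∣ Δ`, `π ∤ c₄` is Step 2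
(`Iₙ`, `n = ord Δ ≥ 1`, `kodairaSymbolOfMinimal_eq_I_iff`). Direction `←`: `Iₙ` with `n ≥ 1` only
comes from Step 2, whose test fails when `π ∣ c₄` (`b₂_normalizeStep2_notMem_iff`), and `I₀` is
excluded by `kodairaSymbolOfMinimal_ne_I_zero` (Steps 3–10 return `II, …, II*`; Step 11 is
unreachable for a minimal equation). Silverman ATAEC IV.9.4, steps 1–11 (pp. 344–346).
[cite: SilvermanATAEC1994, IV.9.4 steps 3–10, pp. 344–346] -/
theorem isAdditive_kodairaSymbolOfMinimal_iff (K : Type*) [Field K] [Algebra R K]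
    [IsFractionRing R K] [PerfectField (IsLocalRing.ResidueField R)] {W : WeierstrassCurve R}
    (hΔ : W.Δ ≠ 0) (hmin : (W.baseChange K).IsMinimal R) :
    W.kodairaSymbolOfMinimal.IsAdditive ↔
      W.Δ ∈ IsLocalRing.maximalIdeal R ∧ W.c₄ ∈ IsLocalRing.maximalIdeal R := by
  constructor
  · rintro ⟨hg, hm⟩
    have hΔm : W.Δ ∈ IsLocalRing.maximalIdeal R := by
      by_contra h
      apply hg
      show W.kodairaSymbolOfMinimal = .I 0
      unfold WeierstrassCurve.kodairaSymbolOfMinimal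
      dsimp only
      rw [if_pos h]
    refine ⟨hΔm, ?_⟩
    by_contra hc
    have hn : (IsDiscreteValuationRing.addVal R W.Δ).toNat ≠ 0 := by
      intro h0
      rw [ENat.toNat_eq_zero] at h0
      rcases h0 with h0 | htop
      · have h1 : ((1 : ℕ) : ℕ∞) ≤ IsDiscreteValuationRing.addVal R W.Δ := by
          rw [← pow_dvd_iff_le_addVal, pow_one]; exact mem_maximalIdeal_iff_dvd.mp hΔm
        rw [h0, Nat.cast_one] at h1
        exact one_ne_zero (nonpos_iff_eq_zero.mp h1)
      · exact hΔ (IsDiscreteValuationRing.addVal_eq_top_iff.mp htop)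
    exact hm ⟨_, hn, (W.kodairaSymbolOfMinimal_eq_I_iff hn).mpr ⟨hΔm, hc, rfl⟩⟩
  · rintro ⟨hΔm, hc⟩
    refine ⟨kodairaSymbolOfMinimal_ne_I_zero K hΔ hmin hΔm, ?_⟩
    rintro ⟨n, hn, h⟩
    exact ((W.kodairaSymbolOfMinimal_eq_I_iff hn).mp h).2.1 hc

end DVR

end TateAlgorithm

end Literature.NumberTheory.DiophantineGeometry

namespace WeierstrassCurve

open Literature.NumberTheory.DiophantineGeometry.TateAlgorithm

section Local

variable {A : Type*} [CommRing A] [IsDedekindDomain A] {K : Type*} [Field K]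
  [Algebra A K] [IsFractionRing A K] (v : HeightOneSpectrum A) (W : WeierstrassCurve K)

/-- **Discharge of `WeierstrassCurve.isAdditive_kodairaSymbolAt_iff`.** For an elliptic curve
`W / K` and a finite place `v` such that the residue field of `O_v` is perfect, the Kodaira symbol
`W.kodairaSymbolAt v` (Tate's algorithm run on the local minimal integral model) is of additive
type (`II, III, IV, Iₙ*, IV*, III*, II*`) iff `W` has additive reduction at `v` (Mathlib's
`HasAdditiveReduction`: `v (Δ_min) > 0` and `v (c₄) > 0`). Steps 3–10 of Silverman ATAEC IV.9.4
are the additive types; Step 1 is good and Step 2 multiplicative reduction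
(`kodairaSymbolOfMinimal_eq_I_iff`); Step 11 does not occur for a minimal equation
(`Literature.NumberTheory.DiophantineGeometry.TateAlgorithm.step11_unreachable`, perfect residue field). AEC VII.5.1(c).
(Dot-notation extension of the Mathlib namespace `WeierstrassCurve`.)
[cite: SilvermanATAEC1994, IV.9.4 steps 3–10, pp. 344–346] [cite: SilvermanAEC2009, VII.5.1(c)] -/
theorem isAdditive_kodairaSymbolAt_iff_holds : isAdditive_kodairaSymbolAt_iff v W := by
  intro hE _
  -- Bridge (AEC VII.5.1(c)): Mathlib's `HasAdditiveReduction` (valuations on `K_v`) for the local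
  -- minimal model `M` says `Δ (M) ∈ 𝔪` and `c₄ (M) ∈ 𝔪` for its integral model over `O_v`
  -- (cf. `WeierstrassCurve.hasAdditiveReductionAt_iff_mem` in `TateAlgorithmOrdDiscriminant`).
  have hmin : (W.localMinimalModel v).IsMinimal (v.adicCompletionIntegers K) := inferInstance
  have hbridge : W.HasAdditiveReductionAt v ↔
      ((W.localMinimalModel v).integralModel (v.adicCompletionIntegers K)).Δ ∈
          IsLocalRing.maximalIdeal (v.adicCompletionIntegers K) ∧
        ((W.localMinimalModel v).integralModel (v.adicCompletionIntegers K)).c₄ ∈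
          IsLocalRing.maximalIdeal (v.adicCompletionIntegers K) := by
    unfold HasAdditiveReductionAt
    rw [hasAdditiveReduction_iff,
      ← integralModel_Δ_eq (v.adicCompletionIntegers K) (W.localMinimalModel v),
      ← integralModel_c₄_eq (v.adicCompletionIntegers K) (W.localMinimalModel v),
      HeightOneSpectrum.valuation_lt_one_iff_mem, HeightOneSpectrum.valuation_lt_one_iff_mem]
    exact ⟨fun h ↦ h.2, fun h ↦ ⟨hmin, h⟩⟩
  rw [kodairaSymbolAt_def, hbridge, localMinimalIntegralModel]
  apply isAdditive_kodairaSymbolOfMinimal_iff (v.adicCompletion K)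
  · rw [ne_eq, ← _root_.map_eq_zero_iff (algebraMap _ (v.adicCompletion K))
      (IsFractionRing.injective _ _), integralModel_Δ_eq, localMinimalModel,
      WeierstrassCurve.minimal, variableChange_Δ]
    refine mul_ne_zero (pow_ne_zero _ (Units.ne_zero _)) ?_
    simp only [WeierstrassCurve.baseChange, map_Δ]
    exact (_root_.map_ne_zero (algebraMap K (v.adicCompletion K))).mpr hE.isUnit.ne_zero
  · rw [baseChange_integralModel_eq]; infer_instance

end Local

end WeierstrassCurve
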